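import Literature.Topology.FourManifolds.CerfGammaFourProofs
import Literature.Topology.FourManifolds.Knots
import HarnessLib

/-!
# Discharge of `isSmoothEmbedding_sphereInclusion`: `𝕊 k ↪ 𝕊 n` is a smooth embedding

Sibling proof file of `Literature/Topology/FourManifolds/Knots.lean` (D-0014: named facts of
Literature are discharged by theorems `<fact>_holds`), proving its named fact
`Literature.Topology.FourManifolds.isSmoothEmbedding_sphereInclusion`: for all `k ≤ n` the standard inclusion
`Literature.sphereInclusion k n h : 𝕊 k → 𝕊 n` (keep the first `k + 1` coordinates, pad with zeros) is a
`C^∞` embedding in the sense of Mathlib's `Manifold.IsSmoothEmbedding (𝓡 k) (𝓡 n) ∞`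
(immersion in charts + topological embedding). Users holding a hypothesis
`(h : isSmoothEmbedding_sphereInclusion)` (e.g. the first field of
`Literature.Topology.FourManifolds.SphereEmbedding.SmoothnessFacts`) can now feed it
`Literature.Topology.FourManifolds.isSmoothEmbedding_sphereInclusion_holds`.

## Informal content and proof

`Literature.Topology.FourManifolds.isSmoothEmbedding_sphereInclusion_holds` proves the named fact
`Literature.Topology.FourManifolds.isSmoothEmbedding_sphereInclusion`. Architecture (Hirsch, *Differential Topology* (1976),
Ch. 1, §3: an embedding is an immersion mapping its domain homeomorphically onto its image;
Thm. 3.1: the submanifolds of `N` are exactly the images of embeddings): the inclusion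
`𝕊 k → 𝕊 n` is the restriction to unit spheres of the linear isometry `ℝᵏ⁺¹ → ℝⁿ⁺¹` padding with
zeros, and for the restriction `f` of any linear isometry `L : E →ₗᵢ[ℝ] E'` to unit spheres:

* `L` intertwines the stereographic projections from `v` and from `L v`, so in Mathlib's charts
  `stereographic' k (-p)`, `stereographic' n (-f p)` the map `f` reads, on all of `ℝᵏ`, as a
  linear isometry `T : ℝᵏ →ₗᵢ ℝⁿ` (`exists_linearIsometry_stereographic'_apply_symm`);
* `T` extends to a linear isomorphism `ℝᵏ × ℝⁿ⁻ᵏ ≃ ℝⁿ`, `(w, 0) ↦ T w` (orthogonal complement of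
  the range; `exists_continuousLinearEquiv_prod_of_linearIsometry`), which is exactly Mathlib's
  chart-level immersion condition `Manifold.IsImmersionAtOfComplement` with complement `ℝⁿ⁻ᵏ`;
* `f` is an isometry, hence a topological embedding.

## The reflection facts and the instance (appended section `ReflectLast`)

The two remaining fields of `Literature.Topology.FourManifolds.SphereEmbedding.SmoothnessFacts`,
`Literature.Topology.FourManifolds.isSmoothEmbedding_reflectLast_comp` and `Literature.Topology.FourManifolds.isSmoothEmbedding_comp_reflectLast` (a sphere
embedding composed on either side with the reflection `reflectLast` of a sphere in its last
coordinate is a sphere embedding; Hirsch (1976), Ch. 1, §3), are discharged as `…_holds` by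
packaging the reflection as the diffeomorphism `Literature.reflectLastDiffeo n : 𝕊ⁿ ≃ₘ 𝕊ⁿ` (smooth as
the restriction of the linear map `Literature.Topology.FourManifolds.reflectLastCLM`, an involution) and invoking the tree's
`Manifold.IsSmoothEmbedding.diffeomorph_comp` (`ClosedBallProofs.lean`) and
`Manifold.IsSmoothEmbedding.comp_diffeomorph` (`CerfGammaFourProofs.lean`) — the two halves of
Mathlib's `proof_wanted IsSmoothEmbedding.comp` available in the tree (hence the import of
`CerfGammaFourProofs`). Feeding them to `SphereEmbedding.SmoothnessFacts.of_reflect` gives the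
instance `Literature.Topology.FourManifolds.SphereEmbedding.smoothnessFacts`: every `[SphereEmbedding.SmoothnessFacts]` binder
of the tree (`SphereEmbedding.standard`, `unknot`, `unknotTwo`, `Knot.mirror`, `Knot.reverse`, …)
is dischargeable by `inferInstance` after importing this file.

## References

* M. W. Hirsch, *Differential Topology*, Graduate Texts in Mathematics 33, Springer (1976),
  Ch. 1, §3 "Embeddings and Immersions": an embedding is an immersion `f : M → N` which maps `M`
  homeomorphically onto its image; Thm. 3.1: a subset `A ⊆ N` of a `C^r` manifold (`r ≥ 1`) is a
  `C^r` submanifold iff it is the image of a `C^r` embedding; applied here to the great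
  subspheres `𝕊ⁿ ∩ (ℝᵏ⁺¹ × 0) ⊆ 𝕊ⁿ`. [cite: Hirsch1976, Ch. 1 §3, Thm. 3.1]
* Mathlib: `Mathlib.Geometry.Manifold.Instances.Sphere` (charts `stereographic'`,
  `stereoInvFunAux`, `OrthonormalBasis.fromOrthogonalSpanSingleton`),
  `Mathlib.Geometry.Manifold.Immersion` (`Manifold.IsImmersionAtOfComplement.mk_of_charts`,
  `Manifold.IsImmersionOfComplement.isImmersion`), `Mathlib.Geometry.Manifold.SmoothEmbedding`
  (`Manifold.IsSmoothEmbedding`).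
-/

open scoped Manifold ContDiff Topology InnerProductSpace
open Function Set Metric Module

noncomputable section

namespace Literature.Topology.FourManifolds

section LinearIsometrySphere

variable {E E' : Type*} [NormedAddCommGroup E] [InnerProductSpace ℝ E]
  [NormedAddCommGroup E'] [InnerProductSpace ℝ E']

/-- A linear isometry `L` intertwines the inverse stereographic projections (Mathlib's
`stereoInvFunAux`) from `v` and from `L v`. [folklore] -/
theorem linearIsometry_map_stereoInvFunAux (L : E →ₗᵢ[ℝ] E') (v w : E) :
    L (stereoInvFunAux v w) = stereoInvFunAux (L v) (L w) := by
  simp only [stereoInvFunAux_apply, map_smul, map_add, LinearIsometry.norm_map]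

/-- A linear isometry `L` maps the hyperplane `vᗮ` into `(L v)ᗮ`. [folklore] -/
theorem linearIsometry_map_mem_orthogonal (L : E →ₗᵢ[ℝ] E') {v w : E} {v' : E'}
    (hv' : v' = L v) (hw : w ∈ (ℝ ∙ v)ᗮ) : L w ∈ (ℝ ∙ v')ᗮ := by
  rw [Submodule.mem_orthogonal_singleton_iff_inner_right] at hw ⊢
  rw [hv', LinearIsometry.inner_map_map, hw]

/-- Let `f` be the restriction to unit spheres of a linear isometry `L : E →ₗᵢ[ℝ] E'` and
`v' = L v`. In the stereographic charts from `v` and from `v'`, `f` reads `w ↦ L w` on `vᗮ`.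
[folklore] -/
theorem stereographic_apply_symm_of_linearIsometry (L : E →ₗᵢ[ℝ] E')
    {f : sphere (0 : E) 1 → sphere (0 : E') 1} (hf : ∀ x, (f x : E') = L x)
    (v : sphere (0 : E) 1) (v' : sphere (0 : E') 1) (hv' : (v' : E') = L v)
    (w : (ℝ ∙ (v : E))ᗮ) :
    stereographic (norm_eq_of_mem_sphere v')
        (f ((stereographic (norm_eq_of_mem_sphere v)).symm w)) =
      ⟨L w, linearIsometry_map_mem_orthogonal L hv' w.2⟩ := by
  set w' : (ℝ ∙ (v' : E'))ᗮ := ⟨L w, linearIsometry_map_mem_orthogonal L hv' w.2⟩ with hw'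
  have h1 : f ((stereographic (norm_eq_of_mem_sphere v)).symm w) =
      stereoInvFun (norm_eq_of_mem_sphere v') w' := by
    apply Subtype.ext
    rw [hf]
    change L (stereoInvFunAux (v : E) w) = stereoInvFunAux (v' : E') (L w)
    rw [linearIsometry_map_stereoInvFunAux, hv']
  rw [h1]
  exact stereo_right_inv _ w'

variable {k n : ℕ} [Fact (finrank ℝ E = k + 1)] [Fact (finrank ℝ E' = n + 1)]

/-- Let `f` be the restriction to unit spheres of a linear isometry `L : E →ₗᵢ[ℝ] E'`
(`dim E = k + 1`, `dim E' = n + 1`) and `v' = L v`. In Mathlib's charts `stereographic' k v` and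
`stereographic' n v'` (stereographic projection followed by linear isometries `Uₖ : vᗮ ≃ ℝᵏ`,
`Uₙ : v'ᗮ ≃ ℝⁿ`), `f` reads `w ↦ Uₙ (L (Uₖ⁻¹ w))` on all of `ℝᵏ`. [folklore] -/
theorem stereographic'_apply_symm_of_linearIsometry (L : E →ₗᵢ[ℝ] E')
    {f : sphere (0 : E) 1 → sphere (0 : E') 1} (hf : ∀ x, (f x : E') = L x)
    (v : sphere (0 : E) 1) (v' : sphere (0 : E') 1) (hv' : (v' : E') = L v)
    (w : EuclideanSpace ℝ (Fin k)) :
    stereographic' n v' (f ((stereographic' k v).symm w)) =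
      (OrthonormalBasis.fromOrthogonalSpanSingleton n (ne_zero_of_mem_unit_sphere v')).repr
        ⟨L ((OrthonormalBasis.fromOrthogonalSpanSingleton k
          (ne_zero_of_mem_unit_sphere v)).repr.symm w),
          linearIsometry_map_mem_orthogonal L hv' (Subtype.coe_prop _)⟩ := by
  simp only [stereographic', OpenPartialHomeomorph.coe_trans_symm,
    Homeomorph.toOpenPartialHomeomorph_symm_apply, LinearIsometryEquiv.coe_symm_toHomeomorph,
    comp_apply, OpenPartialHomeomorph.coe_trans, Homeomorph.toOpenPartialHomeomorph_apply,
    LinearIsometryEquiv.coe_toHomeomorph, EmbeddingLike.apply_eq_iff_eq]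
  exact stereographic_apply_symm_of_linearIsometry L hf v v' hv' _

/-- Let `f` be the restriction to unit spheres of a linear isometry `L : E →ₗᵢ[ℝ] E'`
(`dim E = k + 1`, `dim E' = n + 1`) and `v' = L v`. In Mathlib's charts `stereographic' k v`,
`stereographic' n v'`, the map `f` reads as a linear isometry `T : ℝᵏ →ₗᵢ[ℝ] ℝⁿ` on all of `ℝᵏ`
(namely `T = Uₙ ∘ L|_{vᗮ} ∘ Uₖ⁻¹`). [folklore] -/
theorem exists_linearIsometry_stereographic'_apply_symm (L : E →ₗᵢ[ℝ] E')
    {f : sphere (0 : E) 1 → sphere (0 : E') 1} (hf : ∀ x, (f x : E') = L x)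
    (v : sphere (0 : E) 1) (v' : sphere (0 : E') 1) (hv' : (v' : E') = L v) :
    ∃ T : EuclideanSpace ℝ (Fin k) →ₗᵢ[ℝ] EuclideanSpace ℝ (Fin n),
      ∀ w, stereographic' n v' (f ((stereographic' k v).symm w)) = T w :=
  ⟨{ toLinearMap :=
      (OrthonormalBasis.fromOrthogonalSpanSingleton n
          (ne_zero_of_mem_unit_sphere v')).repr.toLinearEquiv.toLinearMap ∘ₗ
        ((L.toLinearMap ∘ₗ (ℝ ∙ (v : E))ᗮ.subtype).codRestrict (ℝ ∙ (v' : E'))ᗮ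
          fun w => linearIsometry_map_mem_orthogonal L hv' w.2) ∘ₗ
        (OrthonormalBasis.fromOrthogonalSpanSingleton k
          (ne_zero_of_mem_unit_sphere v)).repr.symm.toLinearEquiv.toLinearMap
     norm_map' := fun w => by
      simp only [LinearIsometryEquiv.toLinearEquiv_symm, LinearMap.comp_codRestrict,
        LinearMap.coe_comp, LinearEquiv.coe_coe, LinearIsometryEquiv.coe_toLinearEquiv,
        comp_apply, LinearIsometryEquiv.norm_map, Submodule.coe_norm,
        LinearMap.codRestrict_apply, LinearIsometry.coe_toLinearMap, Submodule.coe_subtype,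
        LinearIsometry.norm_map, LinearIsometryEquiv.coe_symm_toLinearEquiv]
      rw [Submodule.norm_coe, LinearIsometryEquiv.norm_map] },
    fun w => stereographic'_apply_symm_of_linearIsometry L hf v v' hv' w⟩

omit [Fact (finrank ℝ E = k + 1)] [Fact (finrank ℝ E' = n + 1)] in
/-- A linear isometry `T : F →ₗᵢ[ℝ] G` between finite-dimensional inner product spaces with
`dim F + d = dim G` extends to a linear isomorphism `F × ℝᵈ ≃ G` with `(x, 0) ↦ T x` (split `G`
as the range of `T` plus its orthogonal complement, of dimension `d`). [folklore] -/
theorem exists_continuousLinearEquiv_prod_of_linearIsometry {F G : Type*}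
    [NormedAddCommGroup F] [InnerProductSpace ℝ F] [NormedAddCommGroup G]
    [InnerProductSpace ℝ G] [FiniteDimensional ℝ F] [FiniteDimensional ℝ G]
    (T : F →ₗᵢ[ℝ] G) {d : ℕ} (hd : finrank ℝ F + d = finrank ℝ G) :
    ∃ e : (F × EuclideanSpace ℝ (Fin d)) ≃L[ℝ] G, ∀ x, e (x, 0) = T x := by
  have hKd : finrank ℝ (LinearMap.range T.toLinearMap)ᗮ = d := by
    have h1 := Submodule.finrank_add_finrank_orthogonal (LinearMap.range T.toLinearMap)
    rw [LinearMap.finrank_range_of_inj T.injective] at h1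
    omega
  let e₁ : (LinearMap.range T.toLinearMap)ᗮ ≃L[ℝ] EuclideanSpace ℝ (Fin d) :=
    ContinuousLinearEquiv.ofFinrankEq (by rw [hKd, finrank_euclideanSpace_fin])
  let e₀ : (F × (LinearMap.range T.toLinearMap)ᗮ) ≃ₗ[ℝ] G :=
    ((LinearEquiv.ofInjective T.toLinearMap T.injective).prodCongr (LinearEquiv.refl ℝ _))
      ≪≫ₗ (LinearMap.range T.toLinearMap).prodEquivOfIsCompl _ (Submodule.isCompl_orthogonal _)
  refine ⟨((ContinuousLinearEquiv.refl ℝ F).prodCongr e₁.symm).trans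
    e₀.toContinuousLinearEquiv, fun x => ?_⟩
  simp [e₀]

/-- The restriction `f` to unit spheres of a linear isometry `L : E →ₗᵢ[ℝ] E'`
(`dim E = k + 1`, `dim E' = n + 1`) is a `C^m` immersion at every point `p`, with complement
`ℝⁿ⁻ᵏ` (Mathlib's chart-level definition `Manifold.IsImmersionAtOfComplement`, witnessed by the
charts `stereographic' k (-p) = chartAt p`, `stereographic' n (-f p) = chartAt (f p)`, in which `f`
is a linear isometry `ℝᵏ → ℝⁿ` on all of `ℝᵏ`). [folklore] -/
theorem isImmersionAtOfComplement_sphere_of_linearIsometry (L : E →ₗᵢ[ℝ] E')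
    {f : sphere (0 : E) 1 → sphere (0 : E') 1} (hf : ∀ x, (f x : E') = L x) (m : ℕ∞ω)
    (p : sphere (0 : E) 1) :
    Manifold.IsImmersionAtOfComplement (EuclideanSpace ℝ (Fin (n - k))) (𝓡 k) (𝓡 n) m f p := by
  have hv' : ((-f p : sphere (0 : E') 1) : E') = L ((-p : sphere (0 : E) 1) : E) := by
    rw [coe_neg_sphere, coe_neg_sphere, hf, map_neg]
  obtain ⟨T, hT⟩ :=
    exists_linearIsometry_stereographic'_apply_symm (k := k) (n := n) L hf (-p) (-f p) hv'
  have hkn : k ≤ n := by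
    simpa using LinearMap.finrank_le_finrank_of_injective (f := T.toLinearMap) T.injective
  obtain ⟨e, he⟩ := exists_continuousLinearEquiv_prod_of_linearIsometry T (d := n - k)
    (by simp only [finrank_euclideanSpace_fin]; omega)
  refine Manifold.IsImmersionAtOfComplement.mk_of_charts e (stereographic' k (-p))
    (stereographic' n (-f p)) ?_ ?_ ?_ ?_ ?_ ?_
  · -- `p ∈ (stereographic' k (-p)).source = {-p}ᶜ`
    simpa using ne_neg_of_mem_unit_sphere ℝ p
  · -- `f p ∈ (stereographic' n (-f p)).source = {-f p}ᶜ`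
    simpa using ne_neg_of_mem_unit_sphere ℝ (f p)
  · -- both charts are the preferred charts, hence in the maximal atlases
    exact IsManifold.chart_mem_maximalAtlas p
  · exact IsManifold.chart_mem_maximalAtlas (f p)
  · -- `f` maps `{-p}ᶜ` into `{-f p}ᶜ` since `L` is injective
    intro y hy
    simp only [stereographic'_source, mem_compl_iff, mem_singleton_iff, mem_preimage] at hy ⊢
    intro h
    apply hy
    have h' := congrArg (fun z : sphere (0 : E') 1 => (z : E')) h
    simp only [hf, coe_neg_sphere, ← map_neg] at h'
    exact Subtype.ext (by simpa using L.injective h')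
  · -- in these charts `f` reads `w ↦ T w = e (w, 0)` on all of `ℝᵏ`
    intro w _
    rw [OpenPartialHomeomorph.extend_coe_symm, OpenPartialHomeomorph.extend_coe,
      modelWithCornersSelf_coe, modelWithCornersSelf_coe_symm]
    simp only [comp_apply, CompTriple.comp_eq]
    rw [hT, he]

/-- The restriction `f` to unit spheres of a linear isometry `L : E →ₗᵢ[ℝ] E'`
(`dim E = k + 1`, `dim E' = n + 1`) is a `C^m` immersion `𝕊(E) → 𝕊(E')`. [folklore] -/
theorem isImmersion_sphere_of_linearIsometry (L : E →ₗᵢ[ℝ] E')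
    {f : sphere (0 : E) 1 → sphere (0 : E') 1} (hf : ∀ x, (f x : E') = L x) (m : ℕ∞ω) :
    Manifold.IsImmersion (𝓡 k) (𝓡 n) m f :=
  Manifold.IsImmersionOfComplement.isImmersion (F := EuclideanSpace ℝ (Fin (n - k)))
    fun p => isImmersionAtOfComplement_sphere_of_linearIsometry L hf m p

omit [Fact (finrank ℝ E = k + 1)] [Fact (finrank ℝ E' = n + 1)] in
/-- The restriction to unit spheres of a linear isometry is an isometry. [folklore] -/
theorem isometry_sphere_of_linearIsometry (L : E →ₗᵢ[ℝ] E')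
    {f : sphere (0 : E) 1 → sphere (0 : E') 1} (hf : ∀ x, (f x : E') = L x) : Isometry f :=
  Isometry.of_dist_eq fun x y => by rw [Subtype.dist_eq, Subtype.dist_eq, hf, hf, L.dist_map]

/-- The restriction `f` to unit spheres of a linear isometry `L : E →ₗᵢ[ℝ] E'`
(`dim E = k + 1`, `dim E' = n + 1`) is a `C^m` embedding `𝕊(E) ↪ 𝕊(E')` for every `m` (an
immersion in the stereographic charts, and an isometric hence topological embedding); the
great-sphere case of Hirsch (1976), Ch. 1, §3, Thm. 3.1 (submanifolds are images of
embeddings). [cite: Hirsch1976, Ch. 1 §3, Thm. 3.1] -/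
theorem isSmoothEmbedding_sphere_of_linearIsometry (L : E →ₗᵢ[ℝ] E')
    {f : sphere (0 : E) 1 → sphere (0 : E') 1} (hf : ∀ x, (f x : E') = L x) (m : ℕ∞ω) :
    Manifold.IsSmoothEmbedding (𝓡 k) (𝓡 n) m f :=
  ⟨isImmersion_sphere_of_linearIsometry L hf m,
    (isometry_sphere_of_linearIsometry L hf).isEmbedding⟩

end LinearIsometrySphere

/-- Local notation: `𝔼 n` is the model Euclidean space `EuclideanSpace ℝ (Fin n)`. -/
local notation "𝔼 " n:arg => EuclideanSpace ℝ (Fin n)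

/-- For `k ≤ n` the zero-padding map `euclideanInclusion k n : ℝᵏ → ℝⁿ` is (the underlying map
of) a linear isometry. [folklore] -/
theorem exists_linearIsometry_coe_eq_euclideanInclusion {k n : ℕ} (h : k ≤ n) :
    ∃ L : 𝔼 k →ₗᵢ[ℝ] 𝔼 n, ⇑L = euclideanInclusion k n :=
  ⟨{ toFun := euclideanInclusion k n
     map_add' := fun x y => by
       ext i
       simp only [euclideanInclusion_apply, PiLp.add_apply]
       split_ifs <;> simp
     map_smul' := fun c x => by
       ext i
       simp only [euclideanInclusion_apply, PiLp.smul_apply, RingHom.id_apply, smul_eq_mul]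
       split_ifs <;> simp
     norm_map' := norm_euclideanInclusion h }, rfl⟩

/-- **Discharge of the named fact `isSmoothEmbedding_sphereInclusion`**: for `k ≤ n` the standard
inclusion `sphereInclusion k n h : 𝕊 k → 𝕊 n` (keep the first `k + 1` coordinates, pad with
zeros) is a `C^∞` embedding, being the restriction to unit spheres of the zero-padding linear
isometry `ℝᵏ⁺¹ →ₗᵢ ℝⁿ⁺¹` (`isSmoothEmbedding_sphere_of_linearIsometry`). Hirsch (1976), Ch. 1, §3
(embeddings = immersions that are homeomorphisms onto their image; Thm. 3.1).
[cite: Hirsch1976, Ch. 1 §3, Thm. 3.1] -/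
theorem isSmoothEmbedding_sphereInclusion_holds : isSmoothEmbedding_sphereInclusion := by
  intro k n h
  haveI : Fact (finrank ℝ (𝔼 (k + 1)) = k + 1) := ⟨finrank_euclideanSpace_fin⟩
  haveI : Fact (finrank ℝ (𝔼 (n + 1)) = n + 1) := ⟨finrank_euclideanSpace_fin⟩
  obtain ⟨L, hL⟩ := exists_linearIsometry_coe_eq_euclideanInclusion (Nat.succ_le_succ h)
  exact isSmoothEmbedding_sphere_of_linearIsometry L (fun x => by rw [hL]; rfl) ∞

/-- The `Prop`-valued class `SphereEmbedding.SmoothnessFacts` restricted to its first field is now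
a theorem: any instance can be built from `isSmoothEmbedding_sphereInclusion_holds` and the two
remaining reflection facts. [folklore] -/
theorem SphereEmbedding.SmoothnessFacts.of_reflect
    (h₁ : isSmoothEmbedding_reflectLast_comp) (h₂ : isSmoothEmbedding_comp_reflectLast) :
    SphereEmbedding.SmoothnessFacts :=
  ⟨isSmoothEmbedding_sphereInclusion_holds, h₁, h₂⟩

/-! ## The reflection facts; the instance `SphereEmbedding.smoothnessFacts` -/

section ReflectLast

/-- Local notation: `𝕊 n` is the unit sphere in `EuclideanSpace ℝ (Fin (n + 1))`. -/
local notation "𝕊 " n:arg => (Metric.sphere (0 : EuclideanSpace ℝ (Fin (n + 1))) 1)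

/-- The coordinate reflection `(x₀, …, xₙ) ↦ (x₀, …, xₙ₋₁, -xₙ)` of `ℝⁿ⁺¹` as a continuous linear
map (whose restriction to the sphere is `Literature.Topology.FourManifolds.reflectLast`). [folklore] -/
def reflectLastCLM (n : ℕ) : 𝔼 (n + 1) →L[ℝ] 𝔼 (n + 1) where
  toFun v := WithLp.toLp 2 fun i => if i = Fin.last n then -v i else v i
  map_add' x y := by
    ext i
    simp only [PiLp.add_apply]
    split_ifs <;> ring
  map_smul' c x := by
    ext i
    simp only [PiLp.smul_apply, RingHom.id_apply, smul_eq_mul]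
    split_ifs <;> ring
  cont := by
    refine (PiLp.continuous_toLp 2 _).comp (continuous_pi fun i => ?_)
    split_ifs
    · exact (PiLp.continuous_apply 2 _ i).neg
    · exact PiLp.continuous_apply 2 _ i

/-- `reflectLast` is the restriction of `reflectLastCLM` to the sphere. [folklore] -/
theorem coe_reflectLast (n : ℕ) (x : 𝕊 n) :
    (reflectLast n x : 𝔼 (n + 1)) = reflectLastCLM n x := rfl

/-- The reflection of the sphere in the last coordinate is smooth. [folklore] -/
theorem contMDiff_reflectLast (n : ℕ) : ContMDiff (𝓡 n) (𝓡 n) ∞ (reflectLast n) := by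
  haveI := Fact.mk (@finrank_euclideanSpace_fin ℝ _ (n + 1))
  have h1 : ContMDiff (𝓡 n) 𝓘(ℝ, 𝔼 (n + 1)) ∞ fun x : 𝕊 n => reflectLastCLM n x :=
    (reflectLastCLM n).contDiff.comp_contMDiff contMDiff_coe_sphere
  exact h1.codRestrict_sphere fun x => (reflectLast n x).2

/-- **The reflection of `𝕊ⁿ` in the last coordinate is a diffeomorphism** (a smooth involution).
[folklore] -/
def reflectLastDiffeo (n : ℕ) : 𝕊 n ≃ₘ⟮𝓡 n, 𝓡 n⟯ 𝕊 n where
  toFun := reflectLast n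
  invFun := reflectLast n
  left_inv := reflectLast_reflectLast n
  right_inv := reflectLast_reflectLast n
  contMDiff_toFun := contMDiff_reflectLast n
  contMDiff_invFun := contMDiff_reflectLast n

/-- `reflectLastDiffeo n` is `reflectLast n` as a function. [folklore] -/
@[simp]
theorem coe_reflectLastDiffeo (n : ℕ) : ⇑(reflectLastDiffeo n) = reflectLast n := rfl

/-- **Post-composing a sphere embedding with the reflection gives a sphere embedding**: discharge
of the named fact `Literature.Topology.FourManifolds.isSmoothEmbedding_reflectLast_comp` (`Knots.lean`), by the tree's
`Manifold.IsSmoothEmbedding.diffeomorph_comp` (`ClosedBallProofs.lean`) and the diffeomorphism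
`reflectLastDiffeo`. Hirsch (1976), Ch. 1, §3. [cite: HirschDT1976, Ch. 1 §3] -/
theorem isSmoothEmbedding_reflectLast_comp_holds : isSmoothEmbedding_reflectLast_comp := by
  intro k n K
  exact K.isSmoothEmbedding.diffeomorph_comp (reflectLastDiffeo n)

/-- **Pre-composing a sphere embedding with the reflection gives a sphere embedding**: discharge
of the named fact `Literature.Topology.FourManifolds.isSmoothEmbedding_comp_reflectLast` (`Knots.lean`), by the tree's
`Manifold.IsSmoothEmbedding.comp_diffeomorph` (`CerfGammaFourProofs.lean`).
Hirsch (1976), Ch. 1, §3. [cite: HirschDT1976, Ch. 1 §3] -/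
theorem isSmoothEmbedding_comp_reflectLast_holds : isSmoothEmbedding_comp_reflectLast := by
  intro k n K
  exact K.isSmoothEmbedding.comp_diffeomorph (reflectLastDiffeo k)

/-- **All deferred smoothness facts of `Knots.lean` hold**: the fact bundle
`Literature.Topology.FourManifolds.SphereEmbedding.SmoothnessFacts` (standard inclusions and reflections of sphere embeddings
are smooth embeddings) is inhabited (`SmoothnessFacts.of_reflect` above fed with the two
reflection discharges), so the standard embeddings `SphereEmbedding.standard`, the unknot
`Literature.Topology.FourManifolds.unknot`, the unknotted 2-sphere `Literature.Topology.FourManifolds.unknotTwo`, `Knot.mirror` and `Knot.reverse` are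
available unconditionally once this file is imported. [folklore] -/
instance SphereEmbedding.smoothnessFacts : SphereEmbedding.SmoothnessFacts :=
  SphereEmbedding.SmoothnessFacts.of_reflect isSmoothEmbedding_reflectLast_comp_holds
    isSmoothEmbedding_comp_reflectLast_holds

end ReflectLast


end Literature.Topology.FourManifolds
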